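import Literature.NumberTheory.EllipticCurves.LeadingTermBSZAssemblyProofs
import HarnessLib

/-!
# Bhargava–Skinner–Zhang, Cor 22 (the rank-`0` proportion) assembled from its pieces

Third sibling proof file of `Literature.NumberTheory.EllipticCurves.LeadingTerm` around the named fact
`bhargava_skinner_zhang` (**bsd.S27**). `LeadingTermBSZProofs.lean` proves the counting theorems of

> M. Bhargava, C. Skinner, W. Zhang, *A majority of elliptic curves over `ℚ` satisfy the Birch and
> Swinnerton-Dyer conjecture*, arXiv:1407.1826 (v2, 2014)

at a finite height (Thms 21, 23, 25), and `LeadingTermBSZAssemblyProofs.lean` proves the bookkeeping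
of Cor 26 (the rank `≤ 1` proportion) from those counts and the densities of the pieces. This file
proves, in the same vocabulary and by the same method, the bookkeeping of the source's **Cor 22**
(p. 10), verbatim:

> "Corollary 22. When ordered by height, at least `16.50%` of elliptic curves over `ℚ` have both
> algebraic and analytic rank `0`.
> Proof. By definition, a proportion of `μ(S₀(5))` of all elliptic curves over `ℚ` satisfy
> condition (a) of Theorem 5. By Theorem 16, inside the family `S₀(5)` there exists a finite union
> `F` of large subfamilies of density `μ(F) = κ · μ(S₀(5))`, with `κ ≥ .5501`, and having
> equidistributed root number. By Theorem 21, a proportion of `3/8` of elements of `F` have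
> `5`-Selmer rank `0`. Thus, by Theorem 5 and Lemma 20, a proportion of at least
> `3/8 · κ · μ(S₀(5))` of all elliptic curves over `ℚ` have both algebraic and analytic rank `0`.
> By Theorem 16 and Lemma 17, we thus obtain a lower density of greater than
> `3/8 × .5501 × .8 = .16503` of all curves have both algebraic and analytic rank `0`, as stated
> in the corollary."

with Thm 21 (p. 10: "Suppose `F` is a finite union of large families of elliptic curves such that
exactly `50%` of the curves in `F`, when ordered by height, have root number `+1`. Then at least
`3/8` of the curves in `F`, when ordered by height, have `5`-Selmer rank `0`.") entering through the
tree's finite-height form `thm21_count_five`, and Lemma 17 (p. 8: "We have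
`μ(S₀(5)) = 4·5¹⁰/(5(5¹⁰-1)) > .8`.") entering as the lower density `μ₀` of the piece `S₀`.

No new named fact and no new definition is introduced (D-0026): as in the Cor 26 assembly, the deep
inputs — Thm 13 (the `5`-Selmer average `≤ 6` on `F`, Bhargava–Shankar), Thm 16 (`κ`), Thm 5 (the
rank-`0` converse of Skinner–Urban / Skinner, with the `100%` conditions of Lemma 20 as the set `W`),
Thm 15 (Dokchitser–Dokchitser, the tree's named fact `even_selmerRank_sub_torsionRank_iff`) and the
density of `S₀(5)` — are explicit hypotheses, in exactly the shapes used by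
`heightDensityGE_satisfiesBSDRankLeOne_of_pieces` (whose `U₀ ⊆ R ⊆ S₀(5)` branch is this argument on
the residual piece). Gross–Zagier–Kolyvagin is not needed: Thm 5 delivers both ranks.

## Contents

* `cor22_count` (finite height `X`, granted Thm 13's bound `Σ_U #S₅ ≤ (6+η) N_U` on the sum over the
  twist-stable union `U = F ⊆ S₀`): `(3/8 - η/24) · N_U - 2 · N_{¬W} ≤ #{E : H(E) < X, rank = an.rank = 0}`
  — `thm21_count_five` on `U`, and pointwise Thm 5 (`h5`) on `S₀ ∩ W`; the rational-`5`-torsion term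
  of the counting theorem is absorbed in `N_{¬W}` (`hWtors`), as in `cor26_count`.
* `cor22_algebra` (real arithmetic): with `N_{S₀} ≥ (μ₀-θ)N`, `N_U ≥ (κ-θ)N_{S₀}`, `N_{¬W} ≤ θN` and
  `θ ≤ min(ε/3, κ/2)` the count is `≥ (δ - ε)N` for every `δ ≤ 3/8 · κ · μ₀`.
* `heightDensityGE_rankZero_of_pieces`: hence at least a proportion `δ` of all curves, ordered by
  naive height, lie in the height family with `rank E(ℚ) = 0` and `ord_{s=1} L(E,s) = 0`.
* `bsz_cor22_of_pieces`: with the printed values `κ = .5501`, `μ₀ = .8` the assembly gives the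
  printed `.16503`; `bsz_cor22_exact_of_pieces`: with Lemma 17's exact `μ(S₀(5)) = 4·5¹⁰/(5(5¹⁰-1))`
  it gives `3/8 · (5501/10000) · 4·5¹⁰/(5(5¹⁰-1)) = 17190625/104166656 = .1650300…` (the constant
  `c⁰` at which the `pub-bsdpct` cell's row "full BSD off the supersingular set, rank `0`" —
  `HeightDensityFullBSDOffSsRankZero.lean` — takes its rank-`0` input `hA0`).

The correction to Lemma 18 recorded in `LeadingTermBSZAssemblyProofs.lean` concerns `μ(S₁'(5))` only;
Cor 22 uses `S₀(5)` and is unaffected (ibid., module docstring: "Lemma 17 and Cor 22 (`16.50%`) are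
unaffected").

## References

* [BhargavaSkinnerZhang2014] M. Bhargava, C. Skinner, W. Zhang, arXiv:1407.1826v2: Thm 5, Thm 13,
  Thm 15, Thm 16, Lemma 17, Lemma 20, Thm 21, Cor 22 (pp. 8, 10).
* [BhargavaShankar5Selmer2013] M. Bhargava, A. Shankar, arXiv:1312.7859, Thm 31 and §5 (= Thms 13, 16).
* [DokchitserDokchitserAnnals2010] T. Dokchitser, V. Dokchitser, Ann. of Math. 172 (2010), Thm 1.4
  (= Thm 15).
* [SkinnerUrban2014] C. Skinner, E. Urban, Invent. Math. 195 (2014), Thm 2 (= Thm 5, good ordinary);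
  C. Skinner, Pacific J. Math. 283 (2016), Thm C (= Thm 5, multiplicative).
-/

noncomputable section

open scoped Classical
open scoped AddSubgroup
open Filter Topology WeierstrassCurve

namespace Literature.NumberTheory.EllipticCurves

/-! ### Cor 22 at a finite height: from Thm 21's count to the curves of rank `0` -/

section Count

/-- Truth-table lemma for the pointwise step of Cor 22: an event implying `g` off the exceptional
event `q`. [folklore] -/
private theorem ite_le_ite_add_ite_of_imp {p g q : Prop} [Decidable p] [Decidable g] [Decidable q]
    (h : p → ¬ q → g) :
    (if p then (1 : ℝ) else 0) ≤ (if g then (1 : ℝ) else 0) + (if q then (1 : ℝ) else 0) := by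
  have hg0 : (0 : ℝ) ≤ (if g then (1 : ℝ) else 0) := by split_ifs <;> norm_num
  have hq0 : (0 : ℝ) ≤ (if q then (1 : ℝ) else 0) := by split_ifs <;> norm_num
  by_cases hp : p
  · by_cases hq : q
    · rw [if_pos hp, if_pos hq]; linarith
    · rw [if_pos hp, if_neg hq, if_pos (h hp hq)]; linarith
  · rw [if_neg hp]; linarith

/-- **Cor 22 of the source at a finite height `X`.** Data: the piece `S₀` (the source's `S₀(5)`:
condition (a) of Thm 5, good ordinary or multiplicative reduction at `5`), the finite union `U ⊆ S₀`
of large subfamilies of Thm 16 (stable under `E ↦ E₋₁` with reversed root number), and `W` (the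
`100%` conditions of Lemma 20: `E[5]` irreducible and a prime `ℓ ∥ N`, `ℓ ≠ 5`, with `E[5]`
ramified); the criterion of Thm 5 (`h5`: on `S₀ ∩ W`, `S₅(E) = 0 ⟹ rank = an.rank = 0`), rational
`5`-torsion being excluded on `W` (`hWtors`), and Thm 15 (`hDD`). If at height `X` the sum of `#S₅`
over `U` is `≤ (6 + η)` times the number of its members (Thm 13), then
`(3/8 - η/24) · N_U - 2 · N_{¬W} ≤ #{E : H(E) < X, rank E(ℚ) = ord_{s=1} L(E,s) = 0}`:
`thm21_count_five` counts the members of `U` with `#S₅ = 1` (up to the `5`-torsion term, which lives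
off `W`), and each of them in `W` has both ranks `0` by Thm 5.
[cite: BhargavaSkinnerZhang2014, Cor 22 (proof), with Thms 5, 21 and Lemma 20] -/
theorem cor22_count (hDD : even_selmerRank_sub_torsionRank_iff) (S₀ U W : ℤ × ℤ → Prop)
    (hUS₀ : ∀ AB, U AB → S₀ AB) (hU : ∀ AB, U AB → U (negB AB))
    (hUflip : ∀ AB, U AB →
      (shortWeierstrass (negB AB)).rootNumber = -(shortWeierstrass AB).rootNumber)
    (h5 : ∀ AB, IsInHeightFamily AB → S₀ AB → W AB →
      Nat.card ((shortWeierstrass AB).selmerGroup 5) = 1 →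
        (shortWeierstrass AB).mordellWeilRank = 0 ∧ (shortWeierstrass AB).analyticRank = 0)
    (hWtors : ∀ AB, IsInHeightFamily AB → W AB → (shortWeierstrass AB).toAffine.Point[(5 : ℤ)] = ⊥)
    (X : ℕ) {η : ℝ}
    (hsumU : ∑ AB ∈ (heightFamilyBelow X).filter U,
        (Nat.card ((shortWeierstrass AB).selmerGroup 5) : ℝ) ≤
      (6 + η) * ((heightFamilyBelow X).filter U).card) :
    (3 / 8 - η / 24) * ((heightFamilyBelow X).filter U).card -
          2 * ((heightFamilyBelow X).filter (fun AB ↦ ¬ W AB)).card ≤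
      ((heightFamilyBelow X).filter (fun AB ↦ IsInHeightFamily AB ∧
          (shortWeierstrass AB).mordellWeilRank = 0 ∧ (shortWeierstrass AB).analyticRank = 0)).card := by
  haveI : Fact (Nat.Prime 5) := ⟨by norm_num⟩
  set s := heightFamilyBelow X with hs_def
  -- Thm 21 at height `X` (its `(5 : ℕ)` casts are definitionally the literal `5`)
  have h21 := thm21_count_five hDD U hU hUflip X (η := η) hsumU
  simp only [Nat.cast_ofNat] at h21
  -- rational `5`-torsion only occurs off `W`
  have hB : (((s.filter U).filter
      (fun AB ↦ (shortWeierstrass AB).toAffine.Point[(5 : ℤ)] ≠ ⊥)).card : ℝ) ≤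
      (s.filter (fun AB ↦ ¬ W AB)).card := by
    exact_mod_cast Finset.card_le_card fun AB h ↦ by
      simp only [Finset.mem_filter] at h ⊢
      exact ⟨h.1.1, fun hW ↦ h.2 (hWtors AB ((mem_heightFamilyBelow_iff AB X).mp h.1.1).1 hW)⟩
  -- pointwise: a member of `U ⊆ S₀` with trivial `5`-Selmer group has both ranks `0`, unless off `W`
  have key : ∀ AB ∈ s,
      (if U AB ∧ Nat.card ((shortWeierstrass AB).selmerGroup 5) = 1 then (1 : ℝ) else 0) ≤
      (if IsInHeightFamily AB ∧ (shortWeierstrass AB).mordellWeilRank = 0 ∧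
            (shortWeierstrass AB).analyticRank = 0 then (1 : ℝ) else 0) +
        (if ¬ W AB then (1 : ℝ) else 0) := by
    intro AB hAB
    have hfam : IsInHeightFamily AB := ((mem_heightFamilyBelow_iff AB X).mp hAB).1
    refine ite_le_ite_add_ite_of_imp ?_
    rintro ⟨hUAB, h1⟩ hq
    exact ⟨hfam, h5 AB hfam (hUS₀ AB hUAB) (not_not.mp hq) h1⟩
  have hsum := Finset.sum_le_sum key
  rw [Finset.sum_add_distrib, Finset.sum_boole, Finset.sum_boole, Finset.sum_boole] at hsum
  rw [← Finset.filter_filter] at hsum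
  linarith

end Count

/-! ### Cor 22: the bookkeeping of densities (parametrised) and the resulting lower density -/

section Assembly

/-- The real-arithmetic core of Cor 22: with `θ ≤ ε/3`, `θ ≤ κ/2` (so `θ ≤ 1/2`), the finite-height
inequality of `cor22_count` (`hcnt`), the density bounds `N_{S₀} ≥ (μ₀ - θ)N`, `N_U ≥ (κ - θ)N_{S₀}`,
`N_{¬W} ≤ θN`, one gets `#{rank = an.rank = 0} ≥ (δ - ε) N` for every `δ ≤ 3/8 · κ · μ₀` (the
source's `3/8 · κ · μ(S₀(5))`). [cite: BhargavaSkinnerZhang2014, Cor 22 (proof)] -/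
theorem cor22_algebra {N NS NU NW G θ κ μ₀ δ ε : ℝ}
    (hN : 0 ≤ N) (hθ : 0 < θ) (hθε : θ ≤ ε / 3) (hθκ : θ ≤ κ / 2)
    (hκ1 : κ ≤ 1) (hμ0 : 0 ≤ μ₀) (hμ1 : μ₀ ≤ 1)
    (hcnt : (3 / 8 - θ / 24) * NU - 2 * NW ≤ G)
    (h1 : (μ₀ - θ) * N ≤ NS) (h2 : (κ - θ) * NS ≤ NU) (h3 : NW ≤ θ * N)
    (hδ : δ ≤ 3 / 8 * κ * μ₀) :
    (δ - ε) * N ≤ G := by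
  have hκθ : 0 ≤ κ - θ := by linarith
  have hc : 0 ≤ 3 / 8 - θ / 24 := by linarith
  -- chaining the density bounds through the nonnegative coefficients
  have e2 : (3 / 8 - θ / 24) * ((κ - θ) * NS) ≤ (3 / 8 - θ / 24) * NU :=
    mul_le_mul_of_nonneg_left h2 hc
  have e1 : (3 / 8 - θ / 24) * (κ - θ) * ((μ₀ - θ) * N) ≤ (3 / 8 - θ / 24) * (κ - θ) * NS :=
    mul_le_mul_of_nonneg_left h1 (mul_nonneg hc hκθ)
  -- the parameter inequality (loss linear in `θ`, using `0 ≤ κ, μ₀ ≤ 1`, `θ ≤ κ/2 ≤ 1/2`)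
  have p1 : 0 ≤ θ * (1 - κ) := mul_nonneg hθ.le (by linarith)
  have p2 : 0 ≤ θ * (1 - μ₀) := mul_nonneg hθ.le (by linarith)
  have p3 : 0 ≤ θ * (κ * (1 - μ₀)) := mul_nonneg hθ.le (mul_nonneg (by linarith) (by linarith))
  have p4 : 0 ≤ θ ^ 2 * κ := mul_nonneg (sq_nonneg θ) (by linarith)
  have p5 : 0 ≤ θ ^ 2 * μ₀ := mul_nonneg (sq_nonneg θ) hμ0
  have p6 : 0 ≤ θ ^ 2 * (1 - θ) := mul_nonneg (sq_nonneg θ) (by linarith)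
  have k : 3 / 8 * κ * μ₀ - 3 * θ ≤ (3 / 8 - θ / 24) * (κ - θ) * (μ₀ - θ) - 2 * θ := by
    nlinarith [sq_nonneg θ]
  have kN := mul_le_mul_of_nonneg_right k hN
  have hθN := mul_le_mul_of_nonneg_right hθε hN
  have hδN := mul_le_mul_of_nonneg_right hδ hN
  nlinarith

/-- **Cor 22 of the source, assembled from its pieces (parametrised form).** In the notation of
`cor22_count`: suppose Thm 13 bounds the sums of `#S₅` over `U` (`h13U`: eventually `≤ (6 + η) ×`
the number of members, for every `η > 0`), `S₀` has lower density `≥ μ₀` (`hS₀`, Lemma 17), `U` has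
relative lower density `≥ κ` in `S₀` (`hκU`, Thm 16) and the complement of `W` has density `0`
(`hW`, Lemma 20). Then at least a proportion `δ = 3/8 · κ · μ₀` of all curves `E_{A,B}`, ordered by
naive height, have `rank E(ℚ) = 0` and `ord_{s=1} L(E,s) = 0` ("a proportion of at least
`3/8 · κ · μ(S₀(5))` of all elliptic curves over `ℚ` have both algebraic and analytic rank `0`").
[cite: BhargavaSkinnerZhang2014, Cor 22 (proof)] -/
theorem heightDensityGE_rankZero_of_pieces
    (hDD : even_selmerRank_sub_torsionRank_iff) (S₀ U W : ℤ × ℤ → Prop)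
    (hUS₀ : ∀ AB, U AB → S₀ AB) (hU : ∀ AB, U AB → U (negB AB))
    (hUflip : ∀ AB, U AB →
      (shortWeierstrass (negB AB)).rootNumber = -(shortWeierstrass AB).rootNumber)
    (h5 : ∀ AB, IsInHeightFamily AB → S₀ AB → W AB →
      Nat.card ((shortWeierstrass AB).selmerGroup 5) = 1 →
        (shortWeierstrass AB).mordellWeilRank = 0 ∧ (shortWeierstrass AB).analyticRank = 0)
    (hWtors : ∀ AB, IsInHeightFamily AB → W AB → (shortWeierstrass AB).toAffine.Point[(5 : ℤ)] = ⊥)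
    (h13U : ∀ η : ℝ, 0 < η → ∀ᶠ X : ℕ in atTop,
      ∑ AB ∈ (heightFamilyBelow X).filter U,
          (Nat.card ((shortWeierstrass AB).selmerGroup 5) : ℝ) ≤
        (6 + η) * ((heightFamilyBelow X).filter U).card)
    {κ μ₀ : ℝ} (hκ : 0 < κ) (hκ1 : κ ≤ 1) (hμ0 : 0 ≤ μ₀) (hμ1 : μ₀ ≤ 1)
    (hS₀ : ∀ η : ℝ, 0 < η → ∀ᶠ X : ℕ in atTop,
      (μ₀ - η) * (heightFamilyBelow X).card ≤ ((heightFamilyBelow X).filter S₀).card)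
    (hκU : ∀ η : ℝ, 0 < η → ∀ᶠ X : ℕ in atTop,
      (κ - η) * ((heightFamilyBelow X).filter S₀).card ≤ ((heightFamilyBelow X).filter U).card)
    (hW : ∀ η : ℝ, 0 < η → ∀ᶠ X : ℕ in atTop,
      (((heightFamilyBelow X).filter (fun AB ↦ ¬ W AB)).card : ℝ) ≤ η * (heightFamilyBelow X).card)
    {δ : ℝ} (hδ : δ ≤ 3 / 8 * κ * μ₀) :
    HeightDensityGE (fun AB ↦ IsInHeightFamily AB ∧ (shortWeierstrass AB).mordellWeilRank = 0 ∧
      (shortWeierstrass AB).analyticRank = 0) δ := by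
  intro ε hε
  have hθ : 0 < min (ε / 3) (κ / 2) := lt_min (by positivity) (by positivity)
  have hθε : min (ε / 3) (κ / 2) ≤ ε / 3 := min_le_left _ _
  have hθκ : min (ε / 3) (κ / 2) ≤ κ / 2 := min_le_right _ _
  filter_upwards [h13U _ hθ, hS₀ _ hθ, hκU _ hθ, hW _ hθ, eventually_heightFamilyBelow_card_pos]
    with X hX1 hX2 hX3 hX4 hXpos
  have hcnt := cor22_count hDD S₀ U W hUS₀ hU hUflip h5 hWtors X hX1
  have hN : (0 : ℝ) < (heightFamilyBelow X).card := by exact_mod_cast hXpos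
  rw [heightProportion_eq_card_div, le_div_iff₀ hN]
  exact cor22_algebra hN.le hθ hθε hθκ hκ1 hμ0 hμ1 hcnt hX2 hX3 hX4 hδ

/-- **Cor 22 with the printed values gives the printed `16.50%`.** Specialising
`heightDensityGE_rankZero_of_pieces` to `κ = .5501` (Thm 16) and `μ₀ = .8` (Lemma 17:
`μ(S₀(5)) > .8`) yields the source's display `3/8 × .5501 × .8 = .16503`: at least `16.503%` of all
elliptic curves over `ℚ`, ordered by naive height, have both algebraic and analytic rank `0` — granted
the cited inputs, which are the hypotheses. [cite: BhargavaSkinnerZhang2014, Cor 22] -/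
theorem bsz_cor22_of_pieces
    (hDD : even_selmerRank_sub_torsionRank_iff) (S₀ U W : ℤ × ℤ → Prop)
    (hUS₀ : ∀ AB, U AB → S₀ AB) (hU : ∀ AB, U AB → U (negB AB))
    (hUflip : ∀ AB, U AB →
      (shortWeierstrass (negB AB)).rootNumber = -(shortWeierstrass AB).rootNumber)
    (h5 : ∀ AB, IsInHeightFamily AB → S₀ AB → W AB →
      Nat.card ((shortWeierstrass AB).selmerGroup 5) = 1 →
        (shortWeierstrass AB).mordellWeilRank = 0 ∧ (shortWeierstrass AB).analyticRank = 0)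
    (hWtors : ∀ AB, IsInHeightFamily AB → W AB → (shortWeierstrass AB).toAffine.Point[(5 : ℤ)] = ⊥)
    (h13U : ∀ η : ℝ, 0 < η → ∀ᶠ X : ℕ in atTop,
      ∑ AB ∈ (heightFamilyBelow X).filter U,
          (Nat.card ((shortWeierstrass AB).selmerGroup 5) : ℝ) ≤
        (6 + η) * ((heightFamilyBelow X).filter U).card)
    (hS₀ : ∀ η : ℝ, 0 < η → ∀ᶠ X : ℕ in atTop,
      (0.8 - η) * (heightFamilyBelow X).card ≤ ((heightFamilyBelow X).filter S₀).card)
    (hκU : ∀ η : ℝ, 0 < η → ∀ᶠ X : ℕ in atTop,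
      (0.5501 - η) * ((heightFamilyBelow X).filter S₀).card ≤ ((heightFamilyBelow X).filter U).card)
    (hW : ∀ η : ℝ, 0 < η → ∀ᶠ X : ℕ in atTop,
      (((heightFamilyBelow X).filter (fun AB ↦ ¬ W AB)).card : ℝ) ≤ η * (heightFamilyBelow X).card) :
    HeightDensityGE (fun AB ↦ IsInHeightFamily AB ∧ (shortWeierstrass AB).mordellWeilRank = 0 ∧
      (shortWeierstrass AB).analyticRank = 0) 0.16503 :=
  heightDensityGE_rankZero_of_pieces hDD S₀ U W hUS₀ hU hUflip h5 hWtors h13U (by norm_num)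
    (by norm_num) (by norm_num) (by norm_num) hS₀ hκU hW (by norm_num)

/-- **Cor 22 with Lemma 17's exact density gives `3/8 · (5501/10000) · 4·5¹⁰/(5(5¹⁰-1)) =
17190625/104166656 = .1650300…`.** Specialising `heightDensityGE_rankZero_of_pieces` to `κ = .5501`
(Thm 16) and `μ₀ = μ(S₀(5)) = 4·5¹⁰/(5(5¹⁰-1))` (Lemma 17's exact value, `= (4/5)·(1 - 5⁻¹⁰)⁻¹`):
at least a proportion `17190625/104166656` of all elliptic curves over `ℚ`, ordered by naive height,
have both algebraic and analytic rank `0` — granted the cited inputs, which are the hypotheses. (This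
is the constant `c⁰` at which `HeightDensityFullBSDOffSsRankZero.lean` takes its rank-`0` input.)
[cite: BhargavaSkinnerZhang2014, Cor 22 with Lemma 17 and Thm 16] -/
theorem bsz_cor22_exact_of_pieces
    (hDD : even_selmerRank_sub_torsionRank_iff) (S₀ U W : ℤ × ℤ → Prop)
    (hUS₀ : ∀ AB, U AB → S₀ AB) (hU : ∀ AB, U AB → U (negB AB))
    (hUflip : ∀ AB, U AB →
      (shortWeierstrass (negB AB)).rootNumber = -(shortWeierstrass AB).rootNumber)
    (h5 : ∀ AB, IsInHeightFamily AB → S₀ AB → W AB →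
      Nat.card ((shortWeierstrass AB).selmerGroup 5) = 1 →
        (shortWeierstrass AB).mordellWeilRank = 0 ∧ (shortWeierstrass AB).analyticRank = 0)
    (hWtors : ∀ AB, IsInHeightFamily AB → W AB → (shortWeierstrass AB).toAffine.Point[(5 : ℤ)] = ⊥)
    (h13U : ∀ η : ℝ, 0 < η → ∀ᶠ X : ℕ in atTop,
      ∑ AB ∈ (heightFamilyBelow X).filter U,
          (Nat.card ((shortWeierstrass AB).selmerGroup 5) : ℝ) ≤
        (6 + η) * ((heightFamilyBelow X).filter U).card)
    (hS₀ : ∀ η : ℝ, 0 < η → ∀ᶠ X : ℕ in atTop,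
      (4 * 5 ^ 10 / (5 * (5 ^ 10 - 1)) - η) * (heightFamilyBelow X).card ≤
        ((heightFamilyBelow X).filter S₀).card)
    (hκU : ∀ η : ℝ, 0 < η → ∀ᶠ X : ℕ in atTop,
      (0.5501 - η) * ((heightFamilyBelow X).filter S₀).card ≤ ((heightFamilyBelow X).filter U).card)
    (hW : ∀ η : ℝ, 0 < η → ∀ᶠ X : ℕ in atTop,
      (((heightFamilyBelow X).filter (fun AB ↦ ¬ W AB)).card : ℝ) ≤ η * (heightFamilyBelow X).card) :
    HeightDensityGE (fun AB ↦ IsInHeightFamily AB ∧ (shortWeierstrass AB).mordellWeilRank = 0 ∧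
      (shortWeierstrass AB).analyticRank = 0) (17190625 / 104166656) :=
  heightDensityGE_rankZero_of_pieces hDD S₀ U W hUS₀ hU hUflip h5 hWtors h13U (by norm_num)
    (by norm_num) (by norm_num) (by norm_num) hS₀ hκU hW (by norm_num)

end Assembly

end Literature.NumberTheory.EllipticCurves

end
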